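import Summits.QuantumFields.BalabanUV.T4Continuum.Support.NE7OneStepOfSectorApeRep
import Summits.QuantumFields.BalabanUV.T4Continuum.Support.NE7EtaBackgroundFlatStratumZero
import HarnessLib

/-!
# NE7SoftDataPath — A SMALL-DATA PATH FOR EVERY SMALL DATUM AT EVERY TORUS SIZE (compactness: almost flat ⇒ near flat), and THE END OVER A DATA CLASS:
# ONE-STEP for all sufficiently small data ⇐ (APE) ∧ (REP_w^gauge) hypothesised on the CLASS of small data — no path, no gauge in the letters

Cell `pub-balaban`, rung (B)+1 sub-cell t4, lineage `b2b-balaban-t4-ne7-p1`, generation 68 (CRUX PROVER NE7 #1); hunt (h12), memo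
`t4/b2b-balaban-t4-ne7-p1-g68/HUNT-H12-OPEN-BY-MINIMISATION.md` §3bis.  File F29 (over F28 `NE7OneStepOfSectorApeRep.oneStep_of_path_ape_repWgauge`, gen 58's
`NE7EtaBackgroundFlatStratum` (flat admissible lifts of every flat datum, torons included), row NE3's `exists_unitary_gauge_eq_gaugeAct_flatCfg`, F21, F22, F25).

WHY (memo §3bis).  The continuity method's letters are informative only along a path of SMALL data.  F21 ∕ F22's exponential path `τ ↦ e^{τA}` from the flat
configuration has intermediate curvature `≲ η + (commutators of the spread logarithms)`, small for a large coarse torus `N` or by a functional-calculus count —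
not a theorem.  THIS FILE removes the issue SOFTLY and for EVERY `N`: the path need not start at `flatCfg` — ANY flat datum carries flat admissible lifts at every
level ([tree] `blowup_mem_admissible_flatStratum`), so it suffices to join `V` to a NEARBY FLAT datum `F` by the short bondwise geodesic `τ ↦ F e^{τX}`,
`X = log(F⁻¹V)`, whose data stay `4(e^{β} − 1)`-small when `‖X‖ ≤ β` (F21 `expPath_mem_sfClass₀` at a flat base).  That a `γ`-small datum HAS an `ε′`-close flat
datum for `γ = γ(ε′, N, n, d)` is COMPACTNESS of the unitary periodic data (almost flat ⇒ near flat; the constant is inexplicit — the honest price).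
WHAT ([folklore]; 0 def, 0 sorry).
§1 **`exists_flat_near`** — ∀ `ε′ > 0` ∃ `γ > 0`: every unitary `N`-periodic `V` with `SmallField V γ` is bondwise within `ε′` (relative) of a unitary `N`-periodic
   FLAT datum (`IsCompact` of `sfClass`, a cluster point of a bad sequence is flat and has a bad point in every neighbourhood — contradiction);
§2 the geodesic segment from the flat datum: logarithm (F22 `exists_logFun`), end points, smallness of its data (F21);
§3 **`oneStep_of_dataClass_ape_repWgauge`** — THE END OVER A DATA CLASS (generic `d`, `L ≥ 2`, every `N ≥ 1`): if (APE) and (REP_w^gauge) hold at EVERY datum of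
   the class `𝒟_β = {D unitary, N-periodic, SmallField D (4(e^β − 1))}` (shapes of F28, `β > 0` free), then `∃ γ > 0` such that ONE-STEP holds at every unitary
   `N`-periodic `V` with `SmallField V γ`.  No path, no global gauge, no sector condition in the statement; `γ` inexplicit (compactness);
§4 **`oneStep_SU2_of_dataClass_ape_repWgauge`** — `d = 4`, `L = 2`, `card n = 2`, `0 < ε ≤ 10⁻⁵³`: (P♮)_W ∕ level family ∕ class smallness discharged — THE END
   OF RECORD of generation 68.
HONEST FRAMING (page 1): soft topology + kinematics over HYPOTHESES; (APE) (B11 Sect. F TYPE) and REP_w^gauge (Prop. 2 TYPE + smooth-lift sizes) asserted for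
nothing; the threshold `γ` is NOT explicit; NOT ONE-STEP, NOT NE7; spine 0∕9; finite T⁴ rung (B)+1 — NOT infinite volume, NOT mass gap, NOT Clay.  Continuum YM
on T⁴ ⇐ BetaPertH ∧ nine spine estimates (0/9 proved); BetaPertH ⇐ (D1) ∧ (D4) ∧ CAP+tail; G-an2-4 gates asym, D1 and NE2/3/4.
-/

set_option autoImplicit false

open scoped BigOperators Matrix Matrix.Norms.L2Operator Topology
open NormedSpace Finset Set Filter

namespace Summit.QuantumFields.BalabanUV.T4Continuum.NE7SoftDataPath

open Literature.MathematicalPhysics.QuantumFieldTheory.Balaban1983to89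
open B7Prop1Explicit B7Prop2Explicit MatrixLog UnitaryModel
open T4AveragingDeficitWall (IsUnitaryCfg IsSkewDir SmallField vary curl)
open T4AveragingDeficitWallBoundary (IsPeriodicCfg periodBox)
open AveragingDeficitPeriodicCounting (IsPeriodicDir)
open AveragingDeficitTorusChart (redN eq_wrap_add periodic_smul_vec)
open AveragingDeficitFermat (boxVec_redN_mem)
open AveragingDeficitMultiLevelPrep (LevelSmall TangentIter)
open MinimalActionLevels (levelAction perWin)
open MinimalActionSandwich (IsMinimiser admissible)
open MinimalActionRate (sfClass)
open MinimalActionWitness (flatCfg)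
open MinimalActionCompact (isCompact_sfClass isClosed_smallField)
open NE3HessForm (dAction)
open NE3SlicePoincareShape (SlicePoincare slicePoincare_mono)
open NE3SlicePoincareBudgetLine (CPLine)
open NE3ClassRadiusFamily (classSlicePoincare_SU2' CPLine_nonneg_d4_L2)
open NE7ConvOneStepSU2 (levelSmall_all_d4_L2)
open NE7OneStepOfPathOpen (classSmall_d4_L2)
open NE3FrameFreeSliceW (frameFreeBlockLandauW)
open NE3EnergyWeightedShapes (energyNormW)
open NE3EnergyShapes (IsUnitarySite)
open NE3EnergyRateFlatClass (exists_unitary_gauge_eq_gaugeAct_flatCfg)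
open NE3ClassSixFlatWitness (hol_gaugeAct_flatCfg_plaqWord)
open NE7EtaBackgroundFlatStratum (blowup_mem_admissible_flatStratum)
open NE7DataPathExp (continuous_expPath expPath_zero expPath_mem_sfClass₀)
open NE7DataExpChartGlobalGauge (exists_logFun)
open NE7AdmissibleFibreLHC (continuous_relVal)
open NE7OneStepOfSectorApeRep (oneStep_of_path_ape_repWgauge)

noncomputable section

variable {d : ℕ} {n : Type*} [Fintype n] [DecidableEq n]

/-! ## §1 Almost flat ⇒ near flat (compactness of the unitary periodic data) -/

/-- The relative bond deviation `‖F(b)⁻¹V(b) − 1‖` of two `N`-periodic configurations is read on the period box. [folklore] -/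
theorem relNorm_eq_box {N : ℕ} [NeZero N] {F V : Site d → Fin d → (Matrix n n ℂ)ˣ} (hF : IsPeriodicCfg F (N : ℤ)) (hV : IsPeriodicCfg V (N : ℤ))
    (x : Site d) (κ : Fin d) :
    ‖(((F x κ)⁻¹ : (Matrix n n ℂ)ˣ) : Matrix n n ℂ) * (V x κ : Matrix n n ℂ) - 1‖
      = ‖(((F (boxVec N (redN N x)) κ)⁻¹ : (Matrix n n ℂ)ˣ) : Matrix n n ℂ) * (V (boxVec N (redN N x)) κ : Matrix n n ℂ) - 1‖ := by
  have hper : ∀ (y : Site d) (i : Fin d),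
      (fun z => ‖(((F z κ)⁻¹ : (Matrix n n ℂ)ˣ) : Matrix n n ℂ) * (V z κ : Matrix n n ℂ) - 1‖) (y + (N : ℤ) • e i)
        = (fun z => ‖(((F z κ)⁻¹ : (Matrix n n ℂ)ˣ) : Matrix n n ℂ) * (V z κ : Matrix n n ℂ) - 1‖) y := by
    intro y i
    simp only [hF y i κ, hV y i κ]
  conv_lhs => rw [eq_wrap_add N x]
  exact periodic_smul_vec (f := fun z => ‖(((F z κ)⁻¹ : (Matrix n n ℂ)ˣ) : Matrix n n ℂ) * (V z κ : Matrix n n ℂ) - 1‖) hper _ _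

/-- **ALMOST FLAT ⇒ NEAR FLAT** (compactness): for every `ε′ > 0` there is `γ > 0` such that every unitary `N`-periodic configuration with `SmallField V γ` is
bondwise within `ε′` (relative) of a unitary `N`-periodic configuration all of whose plaquette variables are `1`.  Proof: otherwise pick bad `V_j` with
`SmallField V_j (1∕(j+1))`; a cluster point `V⋆` in the compact class ([tree] `isCompact_sfClass`) is `SmallField · 0` (closed conditions), i.e. FLAT, and some
`V_j` lies in the neighbourhood «within `ε′` of `V⋆` on the period box» — contradicting badness (periodicity).  The constant `γ(ε′, N, n, d)` is NOT explicit.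
[folklore] -/
theorem exists_flat_near [Nonempty n] {N : ℕ} [NeZero N] {ε' : ℝ} (hε' : 0 < ε') :
    ∃ γ : ℝ, 0 < γ ∧ ∀ V : Site d → Fin d → (Matrix n n ℂ)ˣ, IsUnitaryCfg V → IsPeriodicCfg V (N : ℤ) → SmallField V γ →
      ∃ F : Site d → Fin d → (Matrix n n ℂ)ˣ, IsUnitaryCfg F ∧ IsPeriodicCfg F (N : ℤ) ∧
        (∀ (x : Site d) (κ μ : Fin d), κ ≠ μ → hol F x (plaqWord κ μ) = 1) ∧
        ∀ (x : Site d) (κ : Fin d), ‖(((F x κ)⁻¹ : (Matrix n n ℂ)ˣ) : Matrix n n ℂ) * (V x κ : Matrix n n ℂ) - 1‖ ≤ ε' := by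
  by_contra hcon
  push Not at hcon
  -- a bad sequence
  have hseq : ∀ j : ℕ, ∃ V : Site d → Fin d → (Matrix n n ℂ)ˣ, IsUnitaryCfg V ∧ IsPeriodicCfg V (N : ℤ) ∧ SmallField V (1 / ((j : ℝ) + 1)) ∧
      ∀ F : Site d → Fin d → (Matrix n n ℂ)ˣ, IsUnitaryCfg F → IsPeriodicCfg F (N : ℤ) →
        (∀ (x : Site d) (κ μ : Fin d), κ ≠ μ → hol F x (plaqWord κ μ) = 1) →
        ∃ (x : Site d) (κ : Fin d), ε' < ‖(((F x κ)⁻¹ : (Matrix n n ℂ)ˣ) : Matrix n n ℂ) * (V x κ : Matrix n n ℂ) - 1‖ :=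
    fun j => hcon (1 / ((j : ℝ) + 1)) (by positivity)
  choose V hVu hVP hVs hVbad using hseq
  -- the compact class containing the sequence
  set K : Set (Site d → Fin d → (Matrix n n ℂ)ˣ) := sfClass d 1 N 1 0 with hKdef
  have hK : IsCompact K := isCompact_sfClass (d := d) (n := n) 1 N 1 0
  have hVK : ∀ j, V j ∈ K := by
    intro j
    refine ⟨hVu j, ?_, ?_⟩
    · simpa using hVP j
    · have h1 : 1 / ((j : ℝ) + 1) ≤ 1 / (((1 : ℕ) : ℝ) ^ 0) ^ 2 := by
        rw [pow_zero, one_pow, div_one]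
        exact (div_le_one (by positivity)).mpr (by linarith [(Nat.cast_nonneg j : (0 : ℝ) ≤ j)])
      exact MinimalActionRate.SmallField.mono (hVs j) h1
  set f : Filter (Site d → Fin d → (Matrix n n ℂ)ˣ) := Filter.map V Filter.atTop with hfdef
  have hfK : f ≤ 𝓟 K := Filter.le_principal_iff.mpr (Filter.eventually_map.mpr (Filter.Eventually.of_forall hVK))
  haveI : f.NeBot := Filter.map_neBot
  obtain ⟨Vs, hVsK, hclu⟩ := hK hfK
  obtain ⟨hVsu, hVsP', -⟩ := hVsK
  have hVsP : IsPeriodicCfg Vs (N : ℤ) := by simpa using hVsP'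
  -- the cluster point is flat
  have hVsmall : ∀ j₀ : ℕ, SmallField Vs (1 / ((j₀ : ℝ) + 1)) := by
    intro j₀
    have hle : f ≤ 𝓟 {U : Site d → Fin d → (Matrix n n ℂ)ˣ | SmallField U (1 / ((j₀ : ℝ) + 1))} := by
      refine Filter.le_principal_iff.mpr (Filter.eventually_map.mpr (Filter.eventually_atTop.mpr ⟨j₀, fun j hj => ?_⟩))
      refine MinimalActionRate.SmallField.mono (hVs j) ?_
      have hj' : (j₀ : ℝ) + 1 ≤ (j : ℝ) + 1 := by exact_mod_cast Nat.succ_le_succ hj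
      exact one_div_le_one_div_of_le (by positivity) hj'
    have hmem : Vs ∈ closure {U : Site d → Fin d → (Matrix n n ℂ)ˣ | SmallField U (1 / ((j₀ : ℝ) + 1))} :=
      mem_closure_iff_clusterPt.mpr (hclu.mono hle)
    rw [(isClosed_smallField (d := d) (n := n) (1 / ((j₀ : ℝ) + 1))).closure_eq] at hmem
    exact hmem
  have hflat : ∀ (x : Site d) (κ μ : Fin d), κ ≠ μ → hol Vs x (plaqWord κ μ) = 1 := by
    intro x κ μ hκ
    have h0 : ‖((hol Vs x (plaqWord κ μ) : (Matrix n n ℂ)ˣ) : Matrix n n ℂ) - 1‖ ≤ 0 := by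
      by_contra hpos
      push Not at hpos
      obtain ⟨j₀, hj₀⟩ := exists_nat_one_div_lt hpos
      have h := hVsmall j₀ x κ μ hκ
      linarith
    have h1 : ((hol Vs x (plaqWord κ μ) : (Matrix n n ℂ)ˣ) : Matrix n n ℂ) = 1 := sub_eq_zero.mp (norm_le_zero_iff.mp h0)
    exact Units.ext h1
  -- the neighbourhood «within ε′ of the cluster point on the period box»
  set O : Set (Site d → Fin d → (Matrix n n ℂ)ˣ) := {U | ∀ x ∈ periodBox (d := d) N, ∀ κ : Fin d,
    ‖(((Vs x κ)⁻¹ : (Matrix n n ℂ)ˣ) : Matrix n n ℂ) * (U x κ : Matrix n n ℂ) - 1‖ < ε'} with hOdef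
  have hOopen : IsOpen O := by
    have e : O = ⋂ x ∈ periodBox (d := d) N, ⋂ κ : Fin d,
        {U : Site d → Fin d → (Matrix n n ℂ)ˣ | ‖(((Vs x κ)⁻¹ : (Matrix n n ℂ)ˣ) : Matrix n n ℂ) * (U x κ : Matrix n n ℂ) - 1‖ < ε'} := by
      ext U; simp only [hOdef, mem_setOf_eq, mem_iInter]
    rw [e]
    refine isOpen_biInter_finset fun x _ => isOpen_iInter_of_finite fun κ => ?_
    exact isOpen_lt ((continuous_relVal Vs x κ).sub continuous_const).norm continuous_const
  have hVsO : Vs ∈ O := by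
    intro x _ κ
    rw [Units.inv_mul, sub_self, norm_zero]
    exact hε'
  have hO : O ∈ 𝓝 Vs := hOopen.mem_nhds hVsO
  -- some member of the bad sequence lies in it
  obtain ⟨U, hUO, ⟨j, rfl⟩⟩ := (clusterPt_iff_nonempty.mp hclu) hO (Filter.range_mem_map)
  obtain ⟨x, κ, hbad⟩ := hVbad j Vs hVsu hVsP hflat
  rw [relNorm_eq_box hVsP (hVP j)] at hbad
  have hgood := hUO (boxVec N (redN N x)) (boxVec_redN_mem N x) κ
  linarith

/-! ## §2 The geodesic segment from a flat datum -/

/-- **THE CHORD FROM A NEARBY UNITARY CONFIGURATION**: for unitary `N`-periodic `F`, `V` there is a skew `N`-periodic `X` with `F(b)·e^{X(b)} = V(b)` and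
`‖X(b)‖ ≤ (π∕2)·‖F(b)⁻¹V(b) − 1‖` (the principal logarithm of F22's `exists_logFun`, bondwise). [folklore] -/
theorem exists_chord (N : ℕ) {F V : Site d → Fin d → (Matrix n n ℂ)ˣ} (hFu : IsUnitaryCfg F) (hFP : IsPeriodicCfg F (N : ℤ))
    (hVu : IsUnitaryCfg V) (hVP : IsPeriodicCfg V (N : ℤ)) :
    ∃ X : Site d → Fin d → Matrix n n ℂ, IsSkewDir X ∧ IsPeriodicDir X (N : ℤ) ∧ vary F X 1 = V ∧
      ∀ (x : Site d) (κ : Fin d), ‖X x κ‖ ≤ Real.pi / 2 * ‖(((F x κ)⁻¹ : (Matrix n n ℂ)ˣ) : Matrix n n ℂ) * (V x κ : Matrix n n ℂ) - 1‖ := by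
  obtain ⟨f, hf⟩ := exists_logFun (n := n)
  have hWu : ∀ (x : Site d) (κ : Fin d), (((F x κ)⁻¹ * V x κ : (Matrix n n ℂ)ˣ) : Matrix n n ℂ) ∈ unitary (Matrix n n ℂ) := fun x κ =>
    mem_unitaryUnits.mp ((unitaryUnits _).mul_mem ((unitaryUnits _).inv_mem (hFu x κ)) (hVu x κ))
  refine ⟨fun x κ => f ((F x κ)⁻¹ * V x κ), fun x κ => (hf _ (hWu x κ)).1, fun x i κ => by simp only [hFP x i κ, hVP x i κ], ?_, fun x κ => ?_⟩
  · funext x κ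
    refine Units.ext ?_
    have hexp := (hf _ (hWu x κ)).2.1
    simp only [vary, Units.val_mul, val_expUnit, Complex.ofReal_one, one_smul, hexp]
    rw [← mul_assoc, Units.mul_inv, one_mul]
  · have h := (hf _ (hWu x κ)).2.2
    simpa only [Units.val_mul] using h

/-! ## §3 The END over a data class -/

/-- **ONE-STEP FOR ALL SUFFICIENTLY SMALL DATA ⇐ (APE) ∧ (REP_w^gauge) ON THE DATA CLASS `𝒟_β`** (generic `d`, `L ≥ 2`, every `N ≥ 1`; `0 ≤ δ₁ < δ < ε`, `β > 0`;
class smallness, the `LevelSmall` family and (P♮)_W with constant `CP` as in F20).  The two letters are asked at every unitary `N`-periodic datum `D` with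
`SmallField D (4(e^β − 1))`, in F28's shapes; the conclusion is the ONE-STEP binder of `NE7InteriorInduction.interior_exists_all_levels` at every unitary `N`-periodic
`V` with `SmallField V γ`, for SOME `γ > 0` depending only on `(β, N, n, d)` (compactness, §1).  Path used: the geodesic segment from a flat datum `ε′`-close to `V`
(§1, `ε′ = β∕2`), whose start carries flat admissible lifts at every level ([tree] `blowup_mem_admissible_flatStratum`) and whose data lie in `𝒟_β` (F21). [folklore] -/
theorem oneStep_of_dataClass_ape_repWgauge [Nonempty n] {L N : ℕ} [NeZero L] [NeZero N] (hL : 2 ≤ L) (hN : 1 ≤ N) {ε δ δ₁ CP β : ℝ} (hε0 : 0 ≤ ε)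
    (hε1 : 16 * C0 d * ε ≤ 3) (hε2 : 1024 * (d + 1) * (d + 4) * (L : ℝ) ^ 2 * ε ≤ 1) (hδ₁ : 0 ≤ δ₁) (hδ₁δ : δ₁ < δ) (hδε : δ < ε) (hCP : 0 < CP)
    (hβ : 0 < β) (hls : ∀ k : ℕ, LevelSmall d L k (ε / ((L : ℝ) ^ (k + 1)) ^ 2))
    (hP : ∀ (j : ℕ) (W' : Site d → Fin d → (Matrix n n ℂ)ˣ), W' ∈ sfClass d L N ε (j + 1) →
      SlicePoincare L (j + 1) W' (frameFreeBlockLandauW L N (j + 1) W') CP (periodBox (d := d) (N * L ^ (j + 1))))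
    (hape : ∀ D : Site d → Fin d → (Matrix n n ℂ)ˣ, IsUnitaryCfg D → IsPeriodicCfg D (N : ℤ) → SmallField D (4 * (Real.exp β - 1)) →
      ∀ (k : ℕ), ∀ U ∈ admissible (sfClass d L N ε) L (k + 1) D, SmallField U (δ / ((L : ℝ) ^ (k + 1)) ^ 2) →
      (∀ φ : Site d → Fin d → Matrix n n ℂ, IsSkewDir φ → IsPeriodicDir φ ((N * L ^ (k + 1) : ℕ) : ℤ) → TangentIter L k U φ →
        dAction U φ (perWin d (N * L ^ (k + 1))) = 0) → SmallField U (δ₁ / ((L : ℝ) ^ (k + 1)) ^ 2))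
    (hrep : ∀ D : Site d → Fin d → (Matrix n n ℂ)ˣ, IsUnitaryCfg D → IsPeriodicCfg D (N : ℤ) → SmallField D (4 * (Real.exp β - 1)) →
      ∀ (k : ℕ), ∀ Us ∈ admissible (sfClass d L N ε) L (k + 1) D, SmallField Us (δ₁ / ((L : ℝ) ^ (k + 1)) ^ 2) →
      (∀ φ : Site d → Fin d → Matrix n n ℂ, IsSkewDir φ → IsPeriodicDir φ ((N * L ^ (k + 1) : ℕ) : ℤ) → TangentIter L k Us φ →
        dAction Us φ (perWin d (N * L ^ (k + 1))) = 0) →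
      ∀ U' ∈ admissible (sfClass d L N ε) L (k + 1) D, ∃ (u : Site d → (Matrix n n ℂ)ˣ) (X XT XN : Site d → Fin d → Matrix n n ℂ)
        (α ν κ₁ : ℝ), IsUnitarySite u ∧ IsSkewDir X ∧ IsPeriodicDir X ((N * L ^ (k + 1) : ℕ) : ℤ) ∧ 0 ≤ α ∧ (∀ x μ, ‖X x μ‖ ≤ α) ∧
        gaugeAct u U' = vary Us X 1 ∧
        X = XT + XN ∧ XT ∈ frameFreeBlockLandauW (d := d) (n := n) L N (k + 1) Us ∧ IsSkewDir XN ∧ 0 ≤ ν ∧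
        energyNormW L (k + 1) Us XN (periodBox (d := d) (N * L ^ (k + 1)))
          ≤ ν * energyNormW L (k + 1) Us X (periodBox (d := d) (N * L ^ (k + 1))) ∧
        ε / ((L : ℝ) ^ (k + 1)) ^ 2 * (∑ p ∈ perWin d (N * L ^ (k + 1)), ‖curl Us XN p‖)
          ≤ κ₁ * energyNormW L (k + 1) Us X (periodBox (d := d) (N * L ^ (k + 1))) ^ 2 ∧
        2 * κ₁ < ((((1 / 2 - ν ^ 2) / (2 * (1 + CP)) - ν ^ 2) / 2
            - 576 * d * (Real.exp α - 1) ^ 2 * ((L : ℝ) ^ (k + 1)) ^ 2) / (Fintype.card n : ℝ)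
            - 28 * d * (ε / ((L : ℝ) ^ (k + 1)) ^ 2 + 7 * α ^ 2) * ((L : ℝ) ^ (k + 1)) ^ 2)) :
    ∃ γ : ℝ, 0 < γ ∧ ∀ V : Site d → Fin d → (Matrix n n ℂ)ˣ, IsUnitaryCfg V → IsPeriodicCfg V (N : ℤ) → SmallField V γ →
      ∀ (k : ℕ) (U₀ : Site d → Fin d → (Matrix n n ℂ)ˣ), U₀ ∈ admissible (sfClass d L N ε) L (k + 1) V →
        SmallField U₀ (δ / ((L : ℝ) ^ k) ^ 2) →
        ∃ U, IsMinimiser d (sfClass d L N ε) L N (k + 1) V U ∧ SmallField U (δ / ((L : ℝ) ^ (k + 1)) ^ 2) := by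
  have hL1 : 1 ≤ L := by omega
  obtain ⟨γ, hγ, hnear⟩ := exists_flat_near (d := d) (n := n) (N := N) (ε' := β / 2) (by positivity)
  refine ⟨γ, hγ, fun V hVu hVP hVγ => ?_⟩
  obtain ⟨F, hFu, hFP, hFflat, hFV⟩ := hnear V hVu hVP hVγ
  -- the flat datum is a pure gauge and carries flat admissible lifts at every level
  obtain ⟨w, hwu, hFw⟩ := exists_unitary_gauge_eq_gaugeAct_flatCfg hFu hFflat
  have hF0 : SmallField F 0 := fun x κ κ' hκ => by rw [hFflat x κ κ' hκ]; simp
  -- the chord and the segment path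
  obtain ⟨X, hXs, hXP, hFX, hXb⟩ := exists_chord N hFu hFP hVu hVP
  have hXβ : ∀ (x : Site d) (κ : Fin d), ‖X x κ‖ ≤ β := by
    intro x κ
    refine (hXb x κ).trans ?_
    have h1 := hFV x κ
    have hπ : Real.pi / 2 ≤ 2 := by linarith [Real.pi_lt_four]
    calc Real.pi / 2 * ‖(((F x κ)⁻¹ : (Matrix n n ℂ)ˣ) : Matrix n n ℂ) * (V x κ : Matrix n n ℂ) - 1‖ ≤ 2 * (β / 2) :=
          mul_le_mul hπ h1 (norm_nonneg _) (by norm_num)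
      _ = β := by ring
  set γp : ℝ → (Site d → Fin d → (Matrix n n ℂ)ˣ) := fun τ => vary F (τ • X) 1 with hγp
  have hγc : ContinuousOn γp (Icc (0 : ℝ) 1) := (continuous_expPath F X).continuousOn
  have hdata : ∀ τ ∈ Icc (0 : ℝ) 1, IsUnitaryCfg (γp τ) ∧ IsPeriodicCfg (γp τ) (N : ℤ) ∧ SmallField (γp τ) (4 * (Real.exp β - 1)) := by
    intro τ hτ
    obtain ⟨h1, h2, h3⟩ := expPath_mem_sfClass₀ L N hFu hFP hF0 hXs hXP hXβ hτ
    refine ⟨h1, by simpa using h2, ?_⟩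
    simpa using h3
  have h0 : ∀ k : ℕ, ∃ U₀ : Site d → Fin d → (Matrix n n ℂ)ˣ, U₀ ∈ admissible (sfClass d L N ε) L (k + 1) (γp 0) ∧ SmallField U₀ 0 := by
    intro k
    have hwP : IsPeriodicCfg (gaugeAct w (flatCfg : Site d → Fin d → (Matrix n n ℂ)ˣ)) (N : ℤ) := by rw [← hFw]; exact hFP
    refine ⟨gaugeAct (fun z : Site d => w (fun i => z i / ((L : ℤ) ^ (k + 1)))) flatCfg, ?_, fun x κ κ' _ => ?_⟩
    · have h := blowup_mem_admissible_flatStratum (d := d) (n := n) (N := N) hL1 hε0 hwu hwP (k + 1)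
      rw [← hFw] at h
      simpa only [hγp, expPath_zero] using h
    · rw [hol_gaugeAct_flatCfg_plaqWord]; simp
  have hγ1 : γp 1 = V := by simp only [hγp, one_smul]; exact hFX
  exact oneStep_of_path_ape_repWgauge hL hN hε0 hε1 hε2 hδ₁ hδ₁δ hδε hCP hls hP γp hγc (fun τ hτ => (hdata τ hτ).1)
    (fun τ hτ => (hdata τ hτ).2.1) h0 hγ1 (fun k τ hτ => hape (γp τ) (hdata τ hτ).1 (hdata τ hτ).2.1 (hdata τ hτ).2.2 k)
    (fun k τ hτ => hrep (γp τ) (hdata τ hτ).1 (hdata τ hτ).2.1 (hdata τ hτ).2.2 k)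

/-! ## §4 The programme's case `d = 4`, `L = 2`, SU(2) ∕ U(2): the END of record of generation 68 -/

/-- **ONE-STEP FOR ALL SUFFICIENTLY SMALL DATA AT `d = 4`, `L = 2`, SU(2)∕U(2) (`card n = 2`), `0 < ε ≤ 10⁻⁵³`, `0 ≤ δ₁ < δ < ε`, `β > 0`, EVERY `N ≥ 1`, FROM (APE) ∧
(REP_w^gauge) ON THE DATA CLASS `𝒟_β` ONLY** — (P♮)_W, the level family and the class smallness discharged ([tree] `classSlicePoincare_SU2'`, `levelSmall_all_d4_L2`,
`classSmall_d4_L2`); constant of record `CP = CPLine 4 2 2 10⁻¹⁷ 10⁻⁵³ + 1`; `γ` inexplicit (compactness). [folklore] -/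
theorem oneStep_SU2_of_dataClass_ape_repWgauge [Nonempty n] (hn : Fintype.card n = 2) {N : ℕ} [NeZero N] (hN : 1 ≤ N) {ε δ δ₁ β : ℝ} (hε : 0 < ε)
    (hε' : ε ≤ 1 / 10 ^ 53) (hδ₁ : 0 ≤ δ₁) (hδ₁δ : δ₁ < δ) (hδε : δ < ε) (hβ : 0 < β)
    (hape : ∀ D : Site 4 → Fin 4 → (Matrix n n ℂ)ˣ, IsUnitaryCfg D → IsPeriodicCfg D (N : ℤ) → SmallField D (4 * (Real.exp β - 1)) →
      ∀ (k : ℕ), ∀ U ∈ admissible (sfClass 4 2 N ε) 2 (k + 1) D, SmallField U (δ / ((((2 : ℕ) : ℝ)) ^ (k + 1)) ^ 2) →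
      (∀ φ : Site 4 → Fin 4 → Matrix n n ℂ, IsSkewDir φ → IsPeriodicDir φ ((N * 2 ^ (k + 1) : ℕ) : ℤ) → TangentIter 2 k U φ →
        dAction U φ (perWin 4 (N * 2 ^ (k + 1))) = 0) → SmallField U (δ₁ / ((((2 : ℕ) : ℝ)) ^ (k + 1)) ^ 2))
    (hrep : ∀ D : Site 4 → Fin 4 → (Matrix n n ℂ)ˣ, IsUnitaryCfg D → IsPeriodicCfg D (N : ℤ) → SmallField D (4 * (Real.exp β - 1)) →
      ∀ (k : ℕ), ∀ Us ∈ admissible (sfClass 4 2 N ε) 2 (k + 1) D, SmallField Us (δ₁ / ((((2 : ℕ) : ℝ)) ^ (k + 1)) ^ 2) →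
      (∀ φ : Site 4 → Fin 4 → Matrix n n ℂ, IsSkewDir φ → IsPeriodicDir φ ((N * 2 ^ (k + 1) : ℕ) : ℤ) → TangentIter 2 k Us φ →
        dAction Us φ (perWin 4 (N * 2 ^ (k + 1))) = 0) →
      ∀ U' ∈ admissible (sfClass 4 2 N ε) 2 (k + 1) D, ∃ (u : Site 4 → (Matrix n n ℂ)ˣ) (X XT XN : Site 4 → Fin 4 → Matrix n n ℂ)
        (α ν κ₁ : ℝ), IsUnitarySite u ∧ IsSkewDir X ∧ IsPeriodicDir X ((N * 2 ^ (k + 1) : ℕ) : ℤ) ∧ 0 ≤ α ∧ (∀ x μ, ‖X x μ‖ ≤ α) ∧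
        gaugeAct u U' = vary Us X 1 ∧
        X = XT + XN ∧ XT ∈ frameFreeBlockLandauW (d := 4) (n := n) 2 N (k + 1) Us ∧ IsSkewDir XN ∧ 0 ≤ ν ∧
        energyNormW 2 (k + 1) Us XN (periodBox (d := 4) (N * 2 ^ (k + 1)))
          ≤ ν * energyNormW 2 (k + 1) Us X (periodBox (d := 4) (N * 2 ^ (k + 1))) ∧
        ε / ((((2 : ℕ) : ℝ)) ^ (k + 1)) ^ 2 * (∑ p ∈ perWin 4 (N * 2 ^ (k + 1)), ‖curl Us XN p‖)
          ≤ κ₁ * energyNormW 2 (k + 1) Us X (periodBox (d := 4) (N * 2 ^ (k + 1))) ^ 2 ∧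
        2 * κ₁ < ((((1 / 2 - ν ^ 2) / (2 * (1 + (CPLine 4 2 2 (1 / 10 ^ 17) (1 / 10 ^ 53) + 1))) - ν ^ 2) / 2
            - 576 * (4 : ℕ) * (Real.exp α - 1) ^ 2 * ((((2 : ℕ) : ℝ)) ^ (k + 1)) ^ 2) / (Fintype.card n : ℝ)
            - 28 * (4 : ℕ) * (ε / ((((2 : ℕ) : ℝ)) ^ (k + 1)) ^ 2 + 7 * α ^ 2) * ((((2 : ℕ) : ℝ)) ^ (k + 1)) ^ 2)) :
    ∃ γ : ℝ, 0 < γ ∧ ∀ V : Site 4 → Fin 4 → (Matrix n n ℂ)ˣ, IsUnitaryCfg V → IsPeriodicCfg V (N : ℤ) → SmallField V γ →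
      ∀ (k : ℕ) (U₀ : Site 4 → Fin 4 → (Matrix n n ℂ)ˣ), U₀ ∈ admissible (sfClass 4 2 N ε) 2 (k + 1) V →
        SmallField U₀ (δ / ((((2 : ℕ) : ℝ)) ^ k) ^ 2) →
        ∃ U, IsMinimiser 4 (sfClass 4 2 N ε) 2 N (k + 1) V U ∧ SmallField U (δ / ((((2 : ℕ) : ℝ)) ^ (k + 1)) ^ 2) := by
  have hP0 := classSlicePoincare_SU2' (n := n) hn hN hε hε'
  have hCP : 0 < CPLine 4 2 2 (1 / 10 ^ 17) (1 / 10 ^ 53) + 1 := by linarith [CPLine_nonneg_d4_L2]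
  have hP : ∀ (j : ℕ) (W : Site 4 → Fin 4 → (Matrix n n ℂ)ˣ), W ∈ sfClass 4 2 N ε (j + 1) →
      SlicePoincare 2 (j + 1) W (frameFreeBlockLandauW 2 N (j + 1) W) (CPLine 4 2 2 (1 / 10 ^ 17) (1 / 10 ^ 53) + 1)
        (periodBox (d := 4) (N * 2 ^ (j + 1))) :=
    fun j W hW => slicePoincare_mono (hP0 j W hW) (by linarith)
  have hls := levelSmall_all_d4_L2 hε.le (hε'.trans (by norm_num))
  obtain ⟨hε1, hε2⟩ := classSmall_d4_L2 hε'
  exact oneStep_of_dataClass_ape_repWgauge (by norm_num) hN hε.le hε1 hε2 hδ₁ hδ₁δ hδε hCP hβ hls hP hape hrep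

end

end Summit.QuantumFields.BalabanUV.T4Continuum.NE7SoftDataPath
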